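import Mathlib
import HarnessLib
import Literature.MathematicalPhysics.KineticTheory.HardSphereEulerProofs
import Literature.Analysis.FluidPDE.HardSphereFlowJointMeasurable
import Literature.Analysis.FluidPDE.HardSphereDynamicsProofs
import Summits.AtomisticToContinuum.HydrodynamicLimit.Theorems.OneFlightGossipEngineKineticCurrentsWindowLDUniformFibreExpMoment
import Summits.AtomisticToContinuum.HydrodynamicLimit.Theorems.OneFlightGossipEngineKineticCurrentsWindowLDUniformPathwiseWindow

/-!
# Ledger assembly for the crux `KineticCurrentsWindowLDUniform` (stmt-AtomisticToContinuum-14662),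
# line `gossip-forecast-ledger`, stub `stub_ledgerAssembly` (S5) — helper file B: statics

Helper file B of the registered stub `stub_ledgerAssembly` of the line skeleton
`Cruxes/KineticCurrentsWindowLDUniform/Lines/gossip_forecast_ledger.lean` (A `…LedgerAssemblyDuality`,
C `…LedgerAssemblyCore`, D `…LedgerAssembly`).  Static exponential moments of group window functionals
under the local Gibbs law `λ_N = localGibbsLaw σ a u₀ θ₀ N Φ` (`σ ≤ 1/2`):

* `exp_mul_norm_sq_mul_localMaxwellian_le`, `lintegral_exp_mul_norm_sq_localMaxwellian_le` — the
  Gaussian fibre bound `∫ e^{s‖v‖²} M_{1,θ,u}(v) dv ≤ 2^{3/2} e^{2s‖u‖²}` for `8 s θ ≤ 1`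
  (complete the square against `M_{1,2θ,u}`);
* `abs_windowSum_le` — on the good set `|Σ_{i∈T} w⁻¹∫₀ʷ F(z_i(r)) dr| ≤ C|T| + C Σ_i ‖v_i‖²` for
  `|F| ≤ C(1+‖v‖²)` (pathwise interval integrability `stub_pathwiseWindow`, energy conservation
  `IsHardSphereTrajectory.configEnergy_eq_holds`);
* `static_expMoment` — hence `∫⁻ e^{c|X_T|} dλ_N < ∞` for all `0 ≤ c ≤ c₀ := 1/(8 sup θ₀ · max C 1)`,
  all `N`, flows, groups `T` and windows `w > 0` (`stub_fibreExpMoment`).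

Reference: H. Spohn, *Large Scale Dynamics of Interacting Particles* (1991), Part I §2.3 (local Gibbs
states); the disintegration API is `HardSphereEulerProofs.lean`.
-/

noncomputable section

open MeasureTheory Set Filter
open scoped ENNReal Topology Classical

namespace Summit.AtomisticToContinuum.HydrodynamicLimit.Theorems.KineticCurrentsWindowLDUniformGossip

open Literature.Analysis.FluidPDE (HardSphereFlow Config localMaxwellian)
open Literature.MathematicalPhysics.KineticTheory (T3 V3 hsDiameter localGibbsLaw localGibbsMeasure
  localMaxwellian_nonneg integrable_localMaxwellian integral_localMaxwellian_one
  isProbabilityMeasure_localGibbsLaw localGibbsLaw_eq)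
open Summit.AtomisticToContinuum.HydrodynamicLimit.Theorems.KineticCurrentsWindowLDUniformSketch
  (stub_fibreExpMoment stub_pathwiseWindow)

namespace LedgerAssembly

/-! ### Statics: Gaussian exponential moments of the kinetic energy -/

section Statics

/-- Gaussian square-exponential moment, pointwise: for `8 s θ ≤ 1`,
`e^{s‖v‖²} M_{1,θ,u}(v) ≤ 2^{3/2} e^{2s‖u‖²} M_{1,2θ,u}(v)`. [folklore] -/
theorem exp_mul_norm_sq_mul_localMaxwellian_le {θ s : ℝ} (hθ : 0 < θ) (hs : 0 ≤ s)
    (hsθ : 8 * s * θ ≤ 1) (u v : V3) :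
    Real.exp (s * ‖v‖ ^ 2) * localMaxwellian 1 θ u v ≤
      (2 : ℝ) ^ ((3 : ℝ) / 2) * Real.exp (2 * s * ‖u‖ ^ 2) * localMaxwellian 1 (2 * θ) u v := by
  have hd : (Module.finrank ℝ V3 : ℝ) = 3 := by
    rw [finrank_euclideanSpace_fin]; norm_num
  unfold localMaxwellian
  rw [hd]
  have hsplit : (2 * Real.pi * (2 * θ)) ^ (-(3 : ℝ) / 2) =
      (2 : ℝ) ^ (-(3 : ℝ) / 2) * (2 * Real.pi * θ) ^ (-(3 : ℝ) / 2) := by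
    rw [show 2 * Real.pi * (2 * θ) = 2 * (2 * Real.pi * θ) by ring]
    exact Real.mul_rpow (by norm_num) (by positivity)
  have h22 : (2 : ℝ) ^ ((3 : ℝ) / 2) * (2 : ℝ) ^ (-(3 : ℝ) / 2) = 1 := by
    rw [← Real.rpow_add two_pos]; norm_num
  have hD : 0 ≤ ‖v - u‖ ^ 2 := sq_nonneg _
  have hv : ‖v‖ ^ 2 ≤ 2 * ‖v - u‖ ^ 2 + 2 * ‖u‖ ^ 2 := by
    have h := norm_add_le (v - u) u
    rw [sub_add_cancel] at h
    nlinarith [norm_nonneg (v - u), norm_nonneg u, norm_nonneg v, sq_nonneg (‖v - u‖ - ‖u‖)]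
  have h1 : s * ‖v‖ ^ 2 ≤ 2 * s * ‖v - u‖ ^ 2 + 2 * s * ‖u‖ ^ 2 := by nlinarith
  have h2 : 2 * s * ‖v - u‖ ^ 2 ≤ ‖v - u‖ ^ 2 / (4 * θ) := by
    rw [le_div_iff₀ (by positivity)]; nlinarith
  have key : s * ‖v‖ ^ 2 + -‖v - u‖ ^ 2 / (2 * θ) ≤
      2 * s * ‖u‖ ^ 2 + -‖v - u‖ ^ 2 / (2 * (2 * θ)) := by
    have h3 : -‖v - u‖ ^ 2 / (2 * θ) = -‖v - u‖ ^ 2 / (2 * (2 * θ)) - ‖v - u‖ ^ 2 / (4 * θ) := by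
      field_simp; ring
    linarith
  have hpos : 0 ≤ (2 * Real.pi * θ) ^ (-(3 : ℝ) / 2) := Real.rpow_nonneg (by positivity) _
  rw [hsplit]
  calc Real.exp (s * ‖v‖ ^ 2) * (1 * (2 * Real.pi * θ) ^ (-(3 : ℝ) / 2) *
        Real.exp (-‖v - u‖ ^ 2 / (2 * θ)))
      = (2 * Real.pi * θ) ^ (-(3 : ℝ) / 2) * Real.exp (s * ‖v‖ ^ 2 + -‖v - u‖ ^ 2 / (2 * θ)) := by
        rw [Real.exp_add]; ring
    _ ≤ (2 * Real.pi * θ) ^ (-(3 : ℝ) / 2) *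
          Real.exp (2 * s * ‖u‖ ^ 2 + -‖v - u‖ ^ 2 / (2 * (2 * θ))) :=
        mul_le_mul_of_nonneg_left (Real.exp_le_exp.2 key) hpos
    _ = (2 : ℝ) ^ ((3 : ℝ) / 2) * (2 : ℝ) ^ (-(3 : ℝ) / 2) * ((2 * Real.pi * θ) ^ (-(3 : ℝ) / 2) *
          (Real.exp (2 * s * ‖u‖ ^ 2) * Real.exp (-‖v - u‖ ^ 2 / (2 * (2 * θ))))) := by
        rw [h22, one_mul, Real.exp_add]
    _ = _ := by ring

/-- Fibre bound: `∫⁻ e^{s‖v‖²} M_{1,θ,u}(v) dv ≤ 2^{3/2} e^{2s‖u‖²}` for `8 s θ ≤ 1`. [folklore] -/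
theorem lintegral_exp_mul_norm_sq_localMaxwellian_le {θ s : ℝ} (hθ : 0 < θ) (hs : 0 ≤ s)
    (hsθ : 8 * s * θ ≤ 1) (u : V3) :
    ∫⁻ v, ENNReal.ofReal (Real.exp (s * ‖v‖ ^ 2)) * ENNReal.ofReal (localMaxwellian 1 θ u v) ≤
      ENNReal.ofReal ((2 : ℝ) ^ ((3 : ℝ) / 2) * Real.exp (2 * s * ‖u‖ ^ 2)) := by
  have hM2 : ∫⁻ v, ENNReal.ofReal (localMaxwellian 1 (2 * θ) u v) = 1 := by
    rw [← ofReal_integral_eq_lintegral_ofReal (integrable_localMaxwellian (by positivity) u)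
      (ae_of_all _ fun v => localMaxwellian_nonneg zero_le_one (by positivity) u v),
      integral_localMaxwellian_one (by positivity), ENNReal.ofReal_one]
  calc ∫⁻ v, ENNReal.ofReal (Real.exp (s * ‖v‖ ^ 2)) * ENNReal.ofReal (localMaxwellian 1 θ u v)
      = ∫⁻ v, ENNReal.ofReal (Real.exp (s * ‖v‖ ^ 2) * localMaxwellian 1 θ u v) :=
        lintegral_congr fun v => (ENNReal.ofReal_mul (Real.exp_pos _).le).symm
    _ ≤ ∫⁻ v, ENNReal.ofReal ((2 : ℝ) ^ ((3 : ℝ) / 2) * Real.exp (2 * s * ‖u‖ ^ 2) *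
          localMaxwellian 1 (2 * θ) u v) :=
        lintegral_mono fun v => ENNReal.ofReal_le_ofReal
          (exp_mul_norm_sq_mul_localMaxwellian_le hθ hs hsθ u v)
    _ = ENNReal.ofReal ((2 : ℝ) ^ ((3 : ℝ) / 2) * Real.exp (2 * s * ‖u‖ ^ 2)) *
          ∫⁻ v, ENNReal.ofReal (localMaxwellian 1 (2 * θ) u v) := by
        rw [← lintegral_const_mul' _ _ ENNReal.ofReal_ne_top]
        exact lintegral_congr fun v => ENNReal.ofReal_mul (by positivity)
    _ = _ := by rw [hM2, mul_one]

/-- Pathwise domination of a group's window functional by the conserved kinetic energy on the good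
set: `|Σ_{i∈T} w⁻¹∫₀ʷ F(z_i(r)) dr| ≤ C·|T| + C Σ_i ‖v_i‖²` for `|F| ≤ C(1+‖v‖²)`. [folklore] -/
theorem abs_windowSum_le {σ : ℝ} {N : ℕ}
    (Φ : HardSphereFlow (Literature.Analysis.FluidPDE.Torus.geometry (Fin 3)) (hsDiameter σ N) (N + 1))
    {F : T3 × V3 → ℝ} (hFc : Continuous F) {C : ℝ} (hC0 : 0 ≤ C)
    (hC : ∀ y, |F y| ≤ C * (1 + ‖y.2‖ ^ 2)) {z : Config (N + 1) (Fin 3) T3} (hz : z ∈ Φ.good)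
    (T : Finset (Fin (N + 1))) {w : ℝ} (hw : 0 < w) :
    |∑ i ∈ T, w⁻¹ * ∫ r in (0 : ℝ)..w, F ((Φ.flow r z) i)| ≤
      C * T.card + C * ∑ i, ‖(z i).2‖ ^ 2 := by
  -- energy conservation along the good trajectory
  have hE : ∀ r, ∑ i, ‖((Φ.flow r z) i).2‖ ^ 2 = ∑ i, ‖(z i).2‖ ^ 2 := by
    intro r
    have h := Literature.Analysis.FluidPDE.IsHardSphereTrajectory.configEnergy_eq_holds
      (Φ.isTrajectory z hz) r 0
    simp only [Φ.flow_zero z hz, Literature.Analysis.FluidPDE.configEnergy] at h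
    have h2 : (2 : ℝ)⁻¹ ≠ 0 := by norm_num
    exact mul_left_cancel₀ h2 h
  -- interval integrability of the observables along the orbit
  have hIF : ∀ i, IntervalIntegrable (fun r => F ((Φ.flow r z) i)) volume 0 w :=
    fun i => stub_pathwiseWindow σ N Φ z hz F hFc i 0 w
  have hGc : Continuous fun y : T3 × V3 => C * (1 + ‖y.2‖ ^ 2) := by fun_prop
  have hIG : ∀ i, IntervalIntegrable (fun r => C * (1 + ‖((Φ.flow r z) i).2‖ ^ 2)) volume 0 w :=
    fun i => stub_pathwiseWindow σ N Φ z hz _ hGc i 0 w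
  -- each term
  have hterm : ∀ i, |w⁻¹ * ∫ r in (0 : ℝ)..w, F ((Φ.flow r z) i)| ≤
      w⁻¹ * ∫ r in (0 : ℝ)..w, C * (1 + ‖((Φ.flow r z) i).2‖ ^ 2) := by
    intro i
    rw [abs_mul, abs_of_pos (inv_pos.2 hw)]
    refine mul_le_mul_of_nonneg_left ?_ (inv_pos.2 hw).le
    exact (intervalIntegral.abs_integral_le_integral_abs hw.le).trans
      (intervalIntegral.integral_mono_on hw.le (hIF i).abs (hIG i) fun r _ => hC _)
  -- sum and swap
  have hsum : ∑ i ∈ T, w⁻¹ * ∫ r in (0 : ℝ)..w, C * (1 + ‖((Φ.flow r z) i).2‖ ^ 2) =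
      w⁻¹ * ∫ r in (0 : ℝ)..w, ∑ i ∈ T, C * (1 + ‖((Φ.flow r z) i).2‖ ^ 2) := by
    rw [intervalIntegral.integral_finsetSum fun i _ => hIG i, Finset.mul_sum]
  have hpt : ∀ r, ∑ i ∈ T, C * (1 + ‖((Φ.flow r z) i).2‖ ^ 2) ≤ C * T.card + C * ∑ i, ‖(z i).2‖ ^ 2 := by
    intro r
    have h1 : ∑ i ∈ T, C * (1 + ‖((Φ.flow r z) i).2‖ ^ 2) =
        C * T.card + C * ∑ i ∈ T, ‖((Φ.flow r z) i).2‖ ^ 2 := by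
      rw [← Finset.mul_sum, ← mul_add, Finset.sum_add_distrib, Finset.sum_const, nsmul_eq_mul,
        mul_one]
    rw [h1, ← hE r]
    have hTle : ∑ i ∈ T, ‖((Φ.flow r z) i).2‖ ^ 2 ≤ ∑ i, ‖((Φ.flow r z) i).2‖ ^ 2 :=
      Finset.sum_le_sum_of_subset_of_nonneg (Finset.subset_univ T) fun i _ _ => sq_nonneg _
    nlinarith [mul_le_mul_of_nonneg_left hTle hC0]
  have hIsum : IntervalIntegrable (fun r => ∑ i ∈ T, C * (1 + ‖((Φ.flow r z) i).2‖ ^ 2)) volume 0 w := by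
    have := IntervalIntegrable.sum T fun i (_ : i ∈ T) => hIG i
    rwa [Finset.sum_fn] at this
  calc |∑ i ∈ T, w⁻¹ * ∫ r in (0 : ℝ)..w, F ((Φ.flow r z) i)|
      ≤ ∑ i ∈ T, |w⁻¹ * ∫ r in (0 : ℝ)..w, F ((Φ.flow r z) i)| := Finset.abs_sum_le_sum_abs _ _
    _ ≤ ∑ i ∈ T, w⁻¹ * ∫ r in (0 : ℝ)..w, C * (1 + ‖((Φ.flow r z) i).2‖ ^ 2) :=
        Finset.sum_le_sum fun i _ => hterm i
    _ = w⁻¹ * ∫ r in (0 : ℝ)..w, ∑ i ∈ T, C * (1 + ‖((Φ.flow r z) i).2‖ ^ 2) := hsum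
    _ ≤ w⁻¹ * ∫ r in (0 : ℝ)..w, (C * T.card + C * ∑ i, ‖(z i).2‖ ^ 2) :=
        mul_le_mul_of_nonneg_left (intervalIntegral.integral_mono_on hw.le hIsum
          intervalIntegrable_const fun r _ => hpt r) (inv_pos.2 hw).le
    _ = C * T.card + C * ∑ i, ‖(z i).2‖ ^ 2 := by
        rw [intervalIntegral.integral_const, sub_zero, smul_eq_mul, ← mul_assoc,
          inv_mul_cancel₀ hw.ne', one_mul]

/-- **Static exponential moments of group window functionals.** For continuous profiles, `σ ≤ 1/2`
and `|F| ≤ C(1+‖v‖²)` there is `c₀ > 0` (depending on `C`, `sup θ₀`, `sup ‖u₀‖` only) such that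
`∫⁻ e^{c|X_T|} dλ_N < ∞` for all `0 ≤ c ≤ c₀`, all `N`, flows, groups `T` and windows `w > 0`. [folklore] -/
theorem static_expMoment {a θ₀ : T3 → ℝ} {u₀ : T3 → V3} (ha : Continuous a) (hθ : Continuous θ₀)
    (hu : Continuous u₀) (ha0 : ∀ x, 0 < a x) (hθ0 : ∀ x, 0 < θ₀ x) {σ : ℝ} (hσ : 0 < σ)
    (hσ2 : σ ≤ 1 / 2) {F : T3 × V3 → ℝ} (hFc : Continuous F) {C : ℝ}
    (hC : ∀ y, |F y| ≤ C * (1 + ‖y.2‖ ^ 2)) :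
    ∃ c₀ : ℝ, 0 < c₀ ∧ ∀ c : ℝ, 0 ≤ c → c ≤ c₀ → ∀ (N : ℕ)
      (Φ : HardSphereFlow (Literature.Analysis.FluidPDE.Torus.geometry (Fin 3)) (hsDiameter σ N) (N + 1))
      (T : Finset (Fin (N + 1))) (w : ℝ), 0 < w →
      ∫⁻ z, ENNReal.ofReal (Real.exp (c * |∑ i ∈ T, w⁻¹ * ∫ r in (0 : ℝ)..w, F ((Φ.flow r z) i)|))
        ∂(localGibbsLaw σ a u₀ θ₀ N Φ) ≠ ∞ := by
  -- constants: `C' = max C 1`, `Θ = sup θ₀`, `U = sup ‖u₀‖`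
  set C' : ℝ := max C 1 with hC'def
  have hC'0 : 0 < C' := lt_of_lt_of_le one_pos (le_max_right _ _)
  have hC' : ∀ y, |F y| ≤ C' * (1 + ‖y.2‖ ^ 2) := fun y =>
    (hC y).trans (mul_le_mul_of_nonneg_right (le_max_left _ _) (by positivity))
  have hΘbdd : BddAbove (Set.range θ₀) := (isCompact_range hθ).bddAbove
  set Θ : ℝ := ⨆ x, θ₀ x with hΘdef
  have hθle : ∀ x, θ₀ x ≤ Θ := fun x => le_ciSup hΘbdd x
  have hΘ0 : 0 < Θ := lt_of_lt_of_le (hθ0 0) (hθle 0)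
  obtain ⟨U, hU⟩ := (isCompact_univ (X := T3)).exists_bound_of_continuousOn hu.continuousOn
  have hU' : ∀ x, ‖u₀ x‖ ≤ U := fun x => hU x (mem_univ x)
  refine ⟨1 / (8 * Θ * C'), by positivity, fun c hc0 hc1 N Φ T w hw => ?_⟩
  -- the Gaussian parameter `s = c C'`
  set s : ℝ := c * C' with hsdef
  have hs0 : 0 ≤ s := by positivity
  have hsθ : ∀ x, 8 * s * θ₀ x ≤ 1 := by
    intro x
    have h1 : c * C' ≤ 1 / (8 * Θ) := by
      rw [le_div_iff₀ (by positivity)] at hc1 ⊢; nlinarith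
    calc 8 * s * θ₀ x ≤ 8 * s * Θ := mul_le_mul_of_nonneg_left (hθle x) (by positivity)
      _ ≤ 8 * (1 / (8 * Θ)) * Θ := by
          exact mul_le_mul_of_nonneg_right (mul_le_mul_of_nonneg_left h1 (by norm_num)) hΘ0.le
      _ = 1 := by field_simp
  -- the law, the good set
  set P := localGibbsLaw σ a u₀ θ₀ N Φ with hPdef
  haveI : IsProbabilityMeasure P := isProbabilityMeasure_localGibbsLaw ha hθ hu ha0 hθ0 hσ2 N Φ
  have hPac : P ≪ Literature.Analysis.FluidPDE.liouville (Literature.Analysis.FluidPDE.Torus.geometry (Fin 3))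
      (N + 1) (hsDiameter σ N) := by
    rw [hPdef, Literature.MathematicalPhysics.KineticTheory.localGibbsLaw,
      Literature.Analysis.FluidPDE.particleLaw_eq]
    exact withDensity_absolutelyContinuous _ _
  have hPgood : P Φ.goodᶜ = 0 := hPac Φ.measure_compl_good
  have hae : ∀ᵐ z ∂P, z ∈ Φ.good := mem_ae_iff.2 hPgood
  -- pointwise domination on the good set
  set g : T3 × V3 → ℝ≥0∞ := fun y => ENNReal.ofReal (Real.exp (s * ‖y.2‖ ^ 2)) with hgdef
  have hgm : Measurable g := by
    rw [hgdef]
    exact (Real.measurable_exp.comp (measurable_const.mul (measurable_snd.norm.pow_const 2))).ennreal_ofReal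
  have hdom : ∀ᵐ z ∂P, ENNReal.ofReal (Real.exp (c * |∑ i ∈ T, w⁻¹ * ∫ r in (0 : ℝ)..w, F ((Φ.flow r z) i)|))
      ≤ ENNReal.ofReal (Real.exp (c * C' * ((N : ℝ) + 1))) * ∏ i, g (z i) := by
    filter_upwards [hae] with z hz
    have hb := abs_windowSum_le Φ hFc hC'0.le hC' hz T hw
    have hcard : (T.card : ℝ) ≤ (N : ℝ) + 1 := by
      have := T.card_le_univ
      rw [Fintype.card_fin] at this
      exact_mod_cast this
    have hb0 : c * |∑ i ∈ T, w⁻¹ * ∫ r in (0 : ℝ)..w, F ((Φ.flow r z) i)| ≤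
        c * C' * ((N : ℝ) + 1) + s * ∑ i, ‖(z i).2‖ ^ 2 := by
      rw [hsdef]
      have := mul_le_mul_of_nonneg_left hb hc0
      nlinarith [mul_le_mul_of_nonneg_left hcard (mul_nonneg hc0 hC'0.le),
        Finset.sum_nonneg (fun i (_ : i ∈ Finset.univ) => sq_nonneg ‖(z i).2‖)]
    have hb' : c * |∑ i ∈ T, w⁻¹ * ∫ r in (0 : ℝ)..w, F ((Φ.flow r z) i)| ≤
        c * C' * ((N : ℝ) + 1) + ∑ i, s * ‖(z i).2‖ ^ 2 := by
      rwa [Finset.mul_sum] at hb0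
    rw [hgdef]
    simp only []
    rw [← ENNReal.ofReal_prod_of_nonneg fun i _ => (Real.exp_pos _).le, ← Real.exp_sum,
      ← ENNReal.ofReal_mul (Real.exp_pos _).le, ← Real.exp_add]
    exact ENNReal.ofReal_le_ofReal (Real.exp_le_exp.2 hb')
  -- fibre moments
  set K : ℝ≥0∞ := ENNReal.ofReal ((2 : ℝ) ^ ((3 : ℝ) / 2) * Real.exp (2 * s * U ^ 2)) with hKdef
  have hfib : ∀ x : T3, ∫⁻ v, g (x, v) * ENNReal.ofReal (localMaxwellian 1 (θ₀ x) (u₀ x) v) ≤ K := by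
    intro x
    refine (lintegral_exp_mul_norm_sq_localMaxwellian_le (hθ0 x) hs0 (hsθ x) (u₀ x)).trans ?_
    refine ENNReal.ofReal_le_ofReal (mul_le_mul_of_nonneg_left (Real.exp_le_exp.2 ?_) (by positivity))
    exact mul_le_mul_of_nonneg_left (pow_le_pow_left₀ (norm_nonneg _) (hU' x) 2) (by positivity)
  have hprod : ∫⁻ z, ∏ i, g (z i) ∂P ≤ K ^ (N + 1) := by
    rw [hPdef, localGibbsLaw_eq]
    exact stub_fibreExpMoment a θ₀ u₀ ha hθ hu ha0 hθ0 σ hσ hσ2 N g hgm K hfib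
  have hfin : ∫⁻ z, ENNReal.ofReal (Real.exp (c * |∑ i ∈ T, w⁻¹ * ∫ r in (0 : ℝ)..w, F ((Φ.flow r z) i)|)) ∂P
      ≤ ENNReal.ofReal (Real.exp (c * C' * ((N : ℝ) + 1))) * K ^ (N + 1) := by
    calc ∫⁻ z, ENNReal.ofReal (Real.exp (c * |∑ i ∈ T, w⁻¹ * ∫ r in (0 : ℝ)..w, F ((Φ.flow r z) i)|)) ∂P
        ≤ ∫⁻ z, ENNReal.ofReal (Real.exp (c * C' * ((N : ℝ) + 1))) * ∏ i, g (z i) ∂P :=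
          lintegral_mono_ae hdom
      _ = ENNReal.ofReal (Real.exp (c * C' * ((N : ℝ) + 1))) * ∫⁻ z, ∏ i, g (z i) ∂P :=
          lintegral_const_mul _ (Finset.measurable_prod _ fun i _ => hgm.comp (measurable_pi_apply i))
      _ ≤ _ := by gcongr
  exact ne_top_of_le_ne_top
    (ENNReal.mul_ne_top ENNReal.ofReal_ne_top (ENNReal.pow_ne_top ENNReal.ofReal_ne_top)) hfin

end Statics

end LedgerAssembly

/-- **Registered helper stub `stub_ledgerAssembly_statics`** (helper file B of S5, line
`gossip-forecast-ledger`, crux stmt-AtomisticToContinuum-14662): static exponential moments of group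
window functionals under the local Gibbs law — for continuous profiles, `0 < σ ≤ 1/2` and a continuous
`F` with `|F| ≤ C(1+‖v‖²)` there is `c₀ > 0` with `∫⁻ e^{c|Σ_{i∈T} w⁻¹∫₀ʷ F(z_i(r)) dr|} dλ_N < ∞` for all
`0 ≤ c ≤ c₀`, `N`, flows, groups `T`, windows `w > 0`. [folklore] -/
theorem stub_ledgerAssembly_statics :
    ∀ (a θ₀ : T3 → ℝ) (u₀ : T3 → V3), Continuous a → Continuous θ₀ → Continuous u₀ →
      (∀ x, 0 < a x) → (∀ x, 0 < θ₀ x) → ∀ σ : ℝ, 0 < σ → σ ≤ 1 / 2 →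
      ∀ (F : T3 × V3 → ℝ), Continuous F → ∀ C : ℝ, (∀ y, |F y| ≤ C * (1 + ‖y.2‖ ^ 2)) →
      ∃ c₀ : ℝ, 0 < c₀ ∧ ∀ c : ℝ, 0 ≤ c → c ≤ c₀ → ∀ (N : ℕ)
        (Φ : HardSphereFlow (Literature.Analysis.FluidPDE.Torus.geometry (Fin 3)) (hsDiameter σ N) (N + 1))
        (T : Finset (Fin (N + 1))) (w : ℝ), 0 < w →
        ∫⁻ z, ENNReal.ofReal (Real.exp (c * |∑ i ∈ T, w⁻¹ * ∫ r in (0 : ℝ)..w, F ((Φ.flow r z) i)|))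
          ∂(localGibbsLaw σ a u₀ θ₀ N Φ) ≠ ∞ :=
  fun _a _θ₀ _u₀ ha hθ hu ha0 hθ0 _σ hσ hσ2 _F hFc _C hC =>
    LedgerAssembly.static_expMoment ha hθ hu ha0 hθ0 hσ hσ2 hFc hC

end Summit.AtomisticToContinuum.HydrodynamicLimit.Theorems.KineticCurrentsWindowLDUniformGossip

end
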